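import Literature.MathematicalPhysics.KineticTheory.LangevinChainReversal
import Summits.AtomisticToContinuum.FouriersLaw.Theorems.BondHeatUncertaintySubdiffusiveBondHeatKernelGibbsC
import Mathlib.MeasureTheory.Integral.Prod

/-!
# `CorrectorTheory` (stmt-AtomisticToContinuum-14071), part 2: the weak Kolmogorov equation against Lebesgue test functions

Helper file for support item `stmt-AtomisticToContinuum-14071`
(`OddSectorIrreversibility.CorrectorTheory`, conjunct A).

For the pinned anharmonic chain `pinnedChain ω₂ lam β γ` (`ω₂ > 0`, `lam, β, γ ≥ 0`, `N ≥ 1`, any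
bath temperatures), forward kernels `P_t` (`OscillatorChain.transitionKernel`, identified with the
model-free `langevinKernel`), a continuous compactly supported observable `v` and a test function
`φ ∈ C²_c`:

  `∫ (P_t v) φ dx - ∫ v φ dx = ∫₀ᵗ ∫ (P_s v) (Lᵀφ) dx ds`,   `Lᵀφ = L̂φ + 2γφ`

(`weak_dynkin_lebesgue`), where `L̂` is the generator of the time-reversed equation (drift `-Y`),
so that `Lᵀ = L̂ + 2γ` is the formal Lebesgue transpose of the generator `L`. This is the
distributional Kolmogorov equation `∂_t (P_t v) = L (P_t v)` tested against `φ(x) dx`, the input of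
the hypoelliptic regularity of the Kubo corrector (next files). Proof: the Lebesgue duality
`dx P_t(x,dy) = e^{2γt} dy P̂_t(y,dx)` (`LangevinChainReversal`), Dynkin's identity for the reversed
kernels `P̂_t` on `C²_c` (`RegularConfinedDrift.sdeKernel_dynkin`) in the weighted form
`e^{2γt} P̂_tφ - φ = ∫₀ᵗ e^{2γs} P̂_s(Lᵀφ) ds` (`revKernel_dynkin_exp`), and Fubini on
`(0,t) × supp v`. All inputs are proved tree theorems. Nothing here closes the item.

References: Cuneo–Eckmann–Hairer–Rey-Bellet 2018, §3.1 (`L*`/`Lᵀ` the formal adjoint);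
Haussmann–Pardoux 1986 (time reversal of diffusions).
-/

noncomputable section

open MeasureTheory ProbabilityTheory Filter Topology Set Function
open scoped NNReal ENNReal ContDiff

namespace Summit.AtomisticToContinuum.FouriersLaw.Theorems.OddSectorIrreversibility.Corrector

open Literature.MathematicalPhysics.KineticTheory.HeatConduction
open Literature.MathematicalPhysics.KineticTheory Literature.Probability.Process OscillatorChain
open Summit.AtomisticToContinuum.FouriersLaw.Theorems.SubdiffusiveBondHeat

variable {N : ℕ}

section Pinned

variable {ω₂ lam β γ : ℝ} (hω : 0 < ω₂) (hl : 0 ≤ lam) (hβ : 0 ≤ β) (hγ : 0 ≤ γ) (N : ℕ) (T_L T_R : ℝ)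
include hω hl hβ hγ

/-- **Dynkin's identity for the reversed kernels with the exponential weight**: for `φ ∈ C²_c`,
`e^{2γt} P̂_tφ(y) - φ(y) = ∫₀ᵗ e^{2γs} P̂_s(L̂φ + 2γφ)(y) ds`, i.e. Dynkin's identity for the
semigroup `e^{2γt}P̂_t` whose generator `L̂ + 2γ` is the Lebesgue transpose of `L`. [folklore] -/
theorem revKernel_dynkin_exp {φ : PhaseSpace N → ℝ} (hφ : ContDiff ℝ 2 φ) (hφc : HasCompactSupport φ)
    (t : ℝ≥0) (y : PhaseSpace N) :
    Real.exp (2 * γ * t) * (∫ x, φ x ∂((pinnedChain ω₂ lam β γ).langevinRevKernel N T_L T_R t y)) - φ y =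
      ∫ s in (0 : ℝ)..t, Real.exp (2 * γ * s) *
        ∫ x, (sdeGenerator (fun z => -(pinnedChain ω₂ lam β γ).drift N z)
          ((pinnedChain ω₂ lam β γ).bathVecL N T_L) ((pinnedChain ω₂ lam β γ).bathVecR N T_R) φ x +
          2 * γ * φ x) ∂((pinnedChain ω₂ lam β γ).langevinRevKernel N T_L T_R s.toNNReal y) := by
  set P := pinnedChain ω₂ lam β γ with hPdef
  have hP : P.IsConfining := pinnedChain_isConfining hω hl hβ hγ
  set D := hP.reversedDrift N with hD
  have hv₁ := hP.bathVecL_mem_reversedDrift_noise N T_L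
  have hv₂ := hP.bathVecR_mem_reversedDrift_noise N T_R
  set Lφ := sdeGenerator (fun z => -P.drift N z) (P.bathVecL N T_L) (P.bathVecR N T_R) φ with hLφ
  set κ := P.langevinRevKernel N T_L T_R with hκ
  haveI : ∀ s, IsMarkovKernel (κ s) := fun s => hP.isMarkovKernel_langevinRevKernel N T_L T_R s
  have hYc : Continuous fun z => -P.drift N z := D.contDiff_drift.continuous
  have hLc : Continuous Lφ := continuous_sdeGenerator _ _ hYc hφ
  obtain ⟨CL, hCL⟩ := exists_bound_sdeGenerator (P.bathVecL N T_L) (P.bathVecR N T_R) hYc hφ hφc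
  obtain ⟨Cφ, hCφ⟩ : ∃ C, ∀ x, ‖φ x‖ ≤ C := hφ.continuous.bounded_above_of_compact_support hφc
  set g : ℝ → ℝ := fun s => ∫ x, φ x ∂(κ s.toNNReal y) with hg
  set h : ℝ → ℝ := fun s => ∫ x, Lφ x ∂(κ s.toNNReal y) with hh
  have hgc : Continuous g := continuous_integral_langevinRevKernel hP N T_L T_R y hφ.continuous hCφ
  have hhc : Continuous h := continuous_integral_langevinRevKernel hP N T_L T_R y hLc hCL
  -- Dynkin for the reversed kernels
  have hdyn : ∀ r : ℝ, 0 ≤ r → g r = φ y + ∫ s in (0 : ℝ)..r, h s := by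
    intro r hr
    have h1 := D.sdeKernel_dynkin hv₁ hv₂ hφ hφc r.toNNReal y
    rw [Real.coe_toNNReal r hr] at h1
    change g r - φ y = ∫ s in (0 : ℝ)..r, h s at h1
    linarith
  -- the weighted function and its derivative on `(0, ∞)`
  set F : ℝ → ℝ := fun s => Real.exp (2 * γ * s) * g s with hF
  set F' : ℝ → ℝ := fun s => Real.exp (2 * γ * s) * ∫ x, (Lφ x + 2 * γ * φ x) ∂(κ s.toNNReal y)
    with hF'
  have hsum : ∀ s : ℝ, ∫ x, (Lφ x + 2 * γ * φ x) ∂(κ s.toNNReal y) = h s + 2 * γ * g s := by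
    intro s
    have i1 : Integrable Lφ (κ s.toNNReal y) := (integrable_const CL).mono' hLc.aestronglyMeasurable
      (Eventually.of_forall hCL)
    have i2 : Integrable (fun x => 2 * γ * φ x) (κ s.toNNReal y) :=
      ((integrable_const Cφ).mono' hφ.continuous.aestronglyMeasurable (Eventually.of_forall hCφ)).const_mul _
    rw [integral_add i1 i2, integral_const_mul]
  have hderiv : ∀ s ∈ Ioo (0 : ℝ) t, HasDerivAt F (F' s) s := by
    intro s hs
    have hG : HasDerivAt (fun r => φ y + ∫ u in (0 : ℝ)..r, h u) (h s) s := by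
      have := intervalIntegral.integral_hasDerivAt_right (hhc.intervalIntegrable 0 s)
        hhc.aestronglyMeasurable.stronglyMeasurableAtFilter hhc.continuousAt
      exact this.const_add _
    have hg' : HasDerivAt g (h s) s := by
      refine hG.congr_of_eventuallyEq ?_
      filter_upwards [Ioi_mem_nhds hs.1] with r hr
      exact hdyn r (le_of_lt hr)
    have hexp : HasDerivAt (fun r => Real.exp (2 * γ * r)) (Real.exp (2 * γ * s) * (2 * γ)) s := by
      have := (hasDerivAt_id s).const_mul (2 * γ)
      simpa using (this.exp)
    have := hexp.mul hg'
    refine this.congr_deriv ?_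
    show _ = Real.exp (2 * γ * s) * ∫ x, (Lφ x + 2 * γ * φ x) ∂(κ s.toNNReal y)
    rw [hsum]
    ring
  have hFc : Continuous F := (Real.continuous_exp.comp (continuous_const.mul continuous_id)).mul hgc
  have hF'c : Continuous F' := by
    have : F' = fun s => Real.exp (2 * γ * s) * (h s + 2 * γ * g s) := funext fun s => by
      show Real.exp (2 * γ * s) * ∫ x, (Lφ x + 2 * γ * φ x) ∂(κ s.toNNReal y) = _
      rw [hsum]
    rw [this]
    exact (Real.continuous_exp.comp (continuous_const.mul continuous_id)).mul
      (hhc.add (continuous_const.mul hgc))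
  have hFTC := intervalIntegral.integral_eq_sub_of_hasDeriv_right_of_le t.coe_nonneg hFc.continuousOn
    (fun s hs => (hderiv s hs).hasDerivWithinAt) (hF'c.intervalIntegrable _ _)
  -- conclude
  have hF0 : F 0 = φ y := by
    rw [hF]
    simp only [mul_zero, Real.exp_zero, one_mul]
    rw [hdyn 0 le_rfl, intervalIntegral.integral_same, add_zero]
  have hFt : F t = Real.exp (2 * γ * t) * ∫ x, φ x ∂(κ t y) := by
    simp only [hF, hg, Real.toNNReal_coe]
  rw [← hFt, ← hF0, ← hFTC]


variable {N} (hN : 0 < N)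
include hN

/-- **One time slice of the Lebesgue duality, Bochner form for separated variables**: for a
continuous compactly supported `v`, a continuous compactly supported `ψ` and `s ≥ 0`,
`∫ (P_s v)(x) ψ(x) dx = e^{2γs} ∫ v(y) (P̂_s ψ)(y) dy`. [folklore] -/
theorem duality_slice {v : PhaseSpace N → ℝ} (hv : Continuous v) (hvc : HasCompactSupport v)
    {ψ : PhaseSpace N → ℝ} (hψ : Continuous ψ) (hψc : HasCompactSupport ψ) (s : ℝ≥0) :
    ∫ x, (∫ y, v y ∂((pinnedChain ω₂ lam β γ).transitionKernel N T_L T_R s x)) * ψ x =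
      Real.exp (2 * γ * s) *
        ∫ y, v y * ∫ x, ψ x ∂((pinnedChain ω₂ lam β γ).langevinRevKernel N T_L T_R s y) := by
  rw [← pinnedChain_langevinKernel_eq_transitionKernel N T_L T_R hω hl hβ hγ]
  set P := pinnedChain ω₂ lam β γ with hPdef
  have hP : P.IsConfining := pinnedChain_isConfining hω hl hβ hγ
  have hU : ContDiff ℝ ∞ P.U := pinnedChain_contDiff_U ω₂ lam β γ
  have hV : ContDiff ℝ ∞ P.V := pinnedChain_contDiff_V ω₂ lam β γ
  haveI := isAddHaarMeasure_volume_phaseSpace N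
  set κ := P.langevinKernel N T_L T_R with hκ
  set κr := P.langevinRevKernel N T_L T_R with hκr
  haveI hMk : ∀ r, IsMarkovKernel (κ r) := fun r => hP.isMarkovKernel_langevinKernel N T_L T_R r
  haveI hMkr : ∀ r, IsMarkovKernel (κr r) := fun r => hP.isMarkovKernel_langevinRevKernel N T_L T_R r
  obtain ⟨Cv, hCv⟩ : ∃ C, ∀ x, ‖v x‖ ≤ C := hv.bounded_above_of_compact_support hvc
  rcases eq_or_ne s 0 with hs | hs
  · -- `s = 0`: both kernels are the identity
    subst hs
    have h1 : κ 0 = Kernel.id := hP.langevinKernel_zero N T_L T_R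
    have h2 : κr 0 = Kernel.id :=
      (hP.reversedDrift N).toConfinedDrift.sdeKernel_zero (hP.bathVecL_mem_reversedDrift_noise N T_L)
        (hP.bathVecR_mem_reversedDrift_noise N T_R)
    simp only [h1, h2, Kernel.id_apply, integral_dirac, NNReal.coe_zero, mul_zero, Real.exp_zero, one_mul]
  -- `s > 0`: the duality of `LangevinChainReversal`
  replace hs : 0 < s := pos_iff_ne_zero.2 hs
  set H : PhaseSpace N × PhaseSpace N → ℝ := fun p => ψ p.1 * v p.2 with hH
  have hHm : AEStronglyMeasurable H ((volume : Measure (PhaseSpace N)) ⊗ₘ κ s) :=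
    ((hψ.comp continuous_fst).mul (hv.comp continuous_snd)).aestronglyMeasurable
  have hHint : Integrable H ((volume : Measure (PhaseSpace N)) ⊗ₘ κ s) := by
    rw [Measure.integrable_compProd_iff hHm]
    constructor
    · refine Eventually.of_forall fun x => ?_
      exact ((integrable_const (μ := κ s x) Cv).mono' hv.aestronglyMeasurable
        (Eventually.of_forall hCv)).const_mul (ψ x)
    · have heq : (fun x => ∫ y, ‖H (x, y)‖ ∂(κ s x)) = fun x => ‖ψ x‖ * ∫ y, ‖v y‖ ∂(κ s x) := by
        funext x
        simp only [hH, norm_mul]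
        exact integral_const_mul _ _
      have hmeas : StronglyMeasurable fun x => ∫ y, ‖v y‖ ∂(κ s x) :=
        hv.norm.stronglyMeasurable.integral_kernel
      have hb : ∀ x, ‖‖ψ x‖ * ∫ y, ‖v y‖ ∂(κ s x)‖ ≤ Cv * ‖ψ x‖ := by
        intro x
        rw [norm_mul, norm_norm, Real.norm_of_nonneg (integral_nonneg fun y => norm_nonneg _), mul_comm]
        refine mul_le_mul_of_nonneg_right ?_ (norm_nonneg _)
        calc ∫ y, ‖v y‖ ∂(κ s x) ≤ ∫ _y, Cv ∂(κ s x) :=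
              integral_mono_of_nonneg (Eventually.of_forall fun y => norm_nonneg _)
                (integrable_const _) (Eventually.of_forall fun y => hCv y)
          _ = Cv := by simp
      rw [heq]
      exact Integrable.mono' ((hψ.norm.integrable_of_hasCompactSupport hψc.norm).const_mul Cv)
        (hψ.norm.aestronglyMeasurable.mul hmeas.aestronglyMeasurable) (Eventually.of_forall hb)
  obtain ⟨-, hdual⟩ := hP.integral_langevinKernel_duality (N := N) T_L T_R hU hV hN hs hHint
  have hl : ∫ x, (∫ y, v y ∂(κ s x)) * ψ x = ∫ x, ∫ y, H (x, y) ∂(κ s x) := by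
    refine integral_congr_ae (Eventually.of_forall fun x => ?_)
    simp only [hH]
    rw [integral_const_mul, mul_comm]
  have hr : ∫ y, v y * ∫ x, ψ x ∂(κr s y) = ∫ y, ∫ x, H (x, y) ∂(κr s y) := by
    refine integral_congr_ae (Eventually.of_forall fun y => ?_)
    simp only [hH]
    rw [integral_mul_const, mul_comm]
  rw [hl, hr]
  exact hdual


/-- **The weak Kolmogorov equation against Lebesgue test functions.** For a continuous compactly
supported `v`, a test function `φ ∈ C²_c` and `t ≥ 0`:
`∫ (P_t v) φ dx - ∫ v φ dx = ∫₀ᵗ ∫ (P_s v)(x) (L̂φ + 2γφ)(x) dx ds`, where `L̂` is the generator of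
the reversed equation, so that `Lᵀ = L̂ + 2γ` is the formal Lebesgue transpose of the generator
`L` — i.e. `∂_t P_t v = L P_t v` in `𝓓'`. [cite: CuneoEckmannHairerReyBellet2018, §3.1] -/
theorem weak_dynkin_lebesgue {v : PhaseSpace N → ℝ} (hv : Continuous v) (hvc : HasCompactSupport v)
    {φ : PhaseSpace N → ℝ} (hφ : ContDiff ℝ 2 φ) (hφc : HasCompactSupport φ) (t : ℝ≥0) :
    (∫ x, (∫ y, v y ∂((pinnedChain ω₂ lam β γ).transitionKernel N T_L T_R t x)) * φ x) -
        ∫ x, v x * φ x =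
      ∫ s in (0 : ℝ)..t,
        ∫ x, (∫ y, v y ∂((pinnedChain ω₂ lam β γ).transitionKernel N T_L T_R s.toNNReal x)) *
          (sdeGenerator (fun z => -(pinnedChain ω₂ lam β γ).drift N z)
            ((pinnedChain ω₂ lam β γ).bathVecL N T_L) ((pinnedChain ω₂ lam β γ).bathVecR N T_R) φ x +
            2 * γ * φ x) := by
  set P := pinnedChain ω₂ lam β γ with hPdef
  have hP : P.IsConfining := pinnedChain_isConfining hω hl hβ hγ
  set κ := P.transitionKernel N T_L T_R with hκ
  set κr := P.langevinRevKernel N T_L T_R with hκr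
  haveI hMk : ∀ r, IsMarkovKernel (κ r) := fun r =>
    pinnedChain_isMarkovKernel_transitionKernel hω hl hβ hγ N T_L T_R r
  haveI hMkr : ∀ r, IsMarkovKernel (κr r) := fun r => hP.isMarkovKernel_langevinRevKernel N T_L T_R r
  set D := hP.reversedDrift N with hD
  have hv₁ := hP.bathVecL_mem_reversedDrift_noise N T_L
  have hv₂ := hP.bathVecR_mem_reversedDrift_noise N T_R
  have hYc : Continuous fun z => -P.drift N z := D.contDiff_drift.continuous
  -- the transposed test function `Lᵀφ = L̂φ + 2γφ`: continuous, compactly supported, bounded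
  set Lφ : PhaseSpace N → ℝ := fun x =>
    sdeGenerator (fun z => -P.drift N z) (P.bathVecL N T_L) (P.bathVecR N T_R) φ x + 2 * γ * φ x
    with hLφ
  have hLc : Continuous Lφ :=
    (continuous_sdeGenerator _ _ hYc hφ).add (continuous_const.mul hφ.continuous)
  have hLcs : HasCompactSupport Lφ :=
    (hasCompactSupport_sdeGenerator _ _ hφc).add (hφc.mul_left)
  obtain ⟨CL, hCL⟩ : ∃ C, ∀ x, ‖Lφ x‖ ≤ C := hLc.bounded_above_of_compact_support hLcs
  -- left-hand side through the duality at time `t` and the weighted reversed Dynkin identity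
  have hlhs : (∫ x, (∫ y, v y ∂(κ t x)) * φ x) - ∫ x, v x * φ x =
      ∫ y, v y * ∫ s in (0 : ℝ)..t, Real.exp (2 * γ * s) * ∫ x, Lφ x ∂(κr s.toNNReal y) := by
    rw [duality_slice hω hl hβ hγ T_L T_R hN hv hvc hφ.continuous hφc t, ← integral_const_mul]
    have hi1 : Integrable (fun y => Real.exp (2 * γ * t) * (v y * ∫ x, φ x ∂(κr t y))) := by
      refine Integrable.const_mul ?_ _
      obtain ⟨Cφ, hCφ⟩ : ∃ C, ∀ x, ‖φ x‖ ≤ C := hφ.continuous.bounded_above_of_compact_support hφc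
      have hm : StronglyMeasurable fun y => ∫ x, φ x ∂(κr t y) :=
        hφ.continuous.stronglyMeasurable.integral_kernel
      refine Integrable.mono' ((hv.norm.integrable_of_hasCompactSupport hvc.norm).mul_const Cφ)
        (hv.aestronglyMeasurable.mul hm.aestronglyMeasurable) (Eventually.of_forall fun y => ?_)
      rw [norm_mul]
      refine mul_le_mul_of_nonneg_left ?_ (norm_nonneg _)
      calc ‖∫ x, φ x ∂(κr t y)‖ ≤ ∫ x, ‖φ x‖ ∂(κr t y) := norm_integral_le_integral_norm _
        _ ≤ ∫ _x, Cφ ∂(κr t y) := integral_mono_of_nonneg (Eventually.of_forall fun x => norm_nonneg _)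
            (integrable_const _) (Eventually.of_forall fun x => hCφ x)
        _ = Cφ := by simp
    have hi2 : Integrable (fun y => v y * φ y) :=
      (hv.mul hφ.continuous).integrable_of_hasCompactSupport (hvc.mul_right)
    rw [← integral_sub hi1 hi2]
    refine integral_congr_ae (Eventually.of_forall fun y => ?_)
    have h := revKernel_dynkin_exp hω hl hβ hγ N T_L T_R hφ hφc t y
    simp only at h ⊢
    rw [← h]
    ring
  rw [hlhs]
  -- Fubini on `(0, t] × supp v`
  have ht0 : (0 : ℝ) ≤ t := t.coe_nonneg
  set G : ℝ → PhaseSpace N → ℝ := fun s y =>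
    v y * (Real.exp (2 * γ * s) * ∫ x, Lφ x ∂(κr s.toNNReal y)) with hG
  have hGm : StronglyMeasurable (Function.uncurry G) := by
    have hK : Measurable fun p : ℝ≥0 × PhaseSpace N => κr p.1 p.2 :=
      D.toConfinedDrift.measurable_sdeKernel hv₁ hv₂
    obtain ⟨K, hKdef⟩ : ∃ K : Kernel (ℝ≥0 × PhaseSpace N) (PhaseSpace N), ∀ p, K p = κr p.1 p.2 :=
      ⟨⟨_, hK⟩, fun p => rfl⟩
    have h1 : StronglyMeasurable fun p : ℝ≥0 × PhaseSpace N => ∫ x, Lφ x ∂(K p) :=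
      hLc.stronglyMeasurable.integral_kernel (κ := K)
    have h2 := h1.comp_measurable (measurable_fst.real_toNNReal.prodMk measurable_snd)
    have h3 : StronglyMeasurable fun p : ℝ × PhaseSpace N => v p.2 * Real.exp (2 * γ * p.1) :=
      ((hv.comp continuous_snd).mul
        (Real.continuous_exp.comp (continuous_const.mul continuous_fst))).stronglyMeasurable
    have heq : Function.uncurry G = fun p : ℝ × PhaseSpace N => (v p.2 * Real.exp (2 * γ * p.1)) *
        ((fun q : ℝ≥0 × PhaseSpace N => ∫ x, Lφ x ∂(K q)) ∘
          (fun q : ℝ × PhaseSpace N => (q.1.toNNReal, q.2))) p := by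
      funext p
      simp only [hG, Function.uncurry, Function.comp, hKdef, mul_assoc]
    rw [heq]
    exact h3.mul h2
  have hGb : ∀ s ∈ Ioc (0 : ℝ) t, ∀ y, ‖G s y‖ ≤ Real.exp (2 * γ * t) * CL * ‖v y‖ := by
    intro s hs y
    simp only [hG, norm_mul, Real.norm_eq_abs, abs_of_pos (Real.exp_pos _)]
    have hI : |∫ x, Lφ x ∂(κr s.toNNReal y)| ≤ CL := by
      rw [← Real.norm_eq_abs]
      calc ‖∫ x, Lφ x ∂(κr s.toNNReal y)‖ ≤ ∫ x, ‖Lφ x‖ ∂(κr s.toNNReal y) :=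
            norm_integral_le_integral_norm _
        _ ≤ ∫ _x, CL ∂(κr s.toNNReal y) := integral_mono_of_nonneg
            (Eventually.of_forall fun x => norm_nonneg _) (integrable_const _)
            (Eventually.of_forall fun x => hCL x)
        _ = CL := by simp
    have hexp : Real.exp (2 * γ * s) ≤ Real.exp (2 * γ * t) :=
      Real.exp_le_exp.2 (mul_le_mul_of_nonneg_left hs.2 (by linarith))
    have hCL0 : 0 ≤ CL := (norm_nonneg _).trans (hCL y)
    calc |v y| * (Real.exp (2 * γ * s) * |∫ x, Lφ x ∂(κr s.toNNReal y)|)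
        ≤ |v y| * (Real.exp (2 * γ * t) * CL) :=
          mul_le_mul_of_nonneg_left (mul_le_mul hexp hI (abs_nonneg _) (Real.exp_pos _).le)
            (abs_nonneg _)
      _ = Real.exp (2 * γ * t) * CL * |v y| := by ring
  have hGint : Integrable (Function.uncurry G)
      ((volume.restrict (Ioc (0 : ℝ) t)).prod (volume : Measure (PhaseSpace N))) := by
    have hdom : Integrable (fun p : ℝ × PhaseSpace N => (Real.exp (2 * γ * t) * CL) * ‖v p.2‖)
        ((volume.restrict (Ioc (0 : ℝ) t)).prod (volume : Measure (PhaseSpace N))) := by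
      have h := Integrable.mul_prod (μ := volume.restrict (Ioc (0 : ℝ) t))
        (integrable_const (Real.exp (2 * γ * t) * CL))
        (hv.norm.integrable_of_hasCompactSupport (μ := (volume : Measure (PhaseSpace N))) hvc.norm)
      exact h
    refine hdom.mono' hGm.aestronglyMeasurable ?_
    have hre : ((volume.restrict (Ioc (0 : ℝ) t)).prod (volume : Measure (PhaseSpace N))) =
        ((volume.restrict (Ioc (0 : ℝ) t)).prod ((volume : Measure (PhaseSpace N)).restrict univ)) := by
      rw [Measure.restrict_univ]
    rw [hre, Measure.prod_restrict, ae_restrict_iff' (measurableSet_Ioc.prod MeasurableSet.univ)]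
    exact Eventually.of_forall fun p hp => hGb p.1 hp.1 p.2
  -- rewrite both sides as iterated integrals over `Ioc 0 t` and swap
  have hL : ∫ y, v y * ∫ s in (0 : ℝ)..t, Real.exp (2 * γ * s) * ∫ x, Lφ x ∂(κr s.toNNReal y) =
      ∫ y, ∫ s in Ioc (0 : ℝ) t, G s y := by
    refine integral_congr_ae (Eventually.of_forall fun y => ?_)
    simp only [hG]
    rw [intervalIntegral.integral_of_le ht0, ← integral_const_mul]
  rw [hL, intervalIntegral.integral_of_le ht0]
  have hGint' : Integrable (Function.uncurry fun (y : PhaseSpace N) (s : ℝ) => G s y)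
      ((volume : Measure (PhaseSpace N)).prod (volume.restrict (Ioc (0 : ℝ) t))) := hGint.swap
  rw [integral_integral_swap hGint']
  refine setIntegral_congr_fun measurableSet_Ioc fun s hs => ?_
  have hs' : (s.toNNReal : ℝ) = s := Real.coe_toNNReal _ hs.1.le
  have hd := duality_slice hω hl hβ hγ T_L T_R hN hv hvc hLc hLcs s.toNNReal
  rw [hs'] at hd
  simp only [hG]
  rw [hd, ← integral_const_mul]
  refine integral_congr_ae (Eventually.of_forall fun y => ?_)
  ring

end Pinned

end Summit.AtomisticToContinuum.FouriersLaw.Theorems.OddSectorIrreversibility.Corrector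

end
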